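import Mathlib
import Summits.ValiantsHypothesis.ValiantsHypothesis.Theses.NewtonUnitEquations
import Summits.ValiantsHypothesis.ValiantsHypothesis.Theorems.NewtonUnitEquationsDissociatedUniformStubExposedGenericDirection
import Summits.ValiantsHypothesis.ValiantsHypothesis.Theorems.NewtonUnitEquationsDissociatedUniformStubTopSurvivorGreedy
import Summits.ValiantsHypothesis.ValiantsHypothesis.Theorems.NewtonUnitEquationsDissociatedUniformStubCoveringFamily
import Summits.ValiantsHypothesis.ValiantsHypothesis.Theorems.NewtonUnitEquationsDissociatedUniformStubCoeffFormula

/-!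
# `DissociatedUniform` is equivalent to its `k`-letter case (alphabet reduction `t ↦ k`)

The composition of line `greedy-basis-shadow` for crux stmt-ValiantsHypothesis-5905
(`Summit.ValiantsHypothesis.ValiantsHypothesis.Theses.NewtonUnitEquations.DissociatedUniform`) as a tree theorem:

* `dissociatedUniform_of_kLetterFrame` — if the crux holds on dissociated frames with `≤ k` letters per coordinate
  (bound `(k·m·k + 2)^C`; this is the line's registered open stub `stub_kLetterFrame`), then it holds in general
  (bound `(k·m·t + 2)^(2C + c)`);
* `dissociatedUniform_iff_kLetterFrame` — together with the specialisation `t := k`.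

Proof: a vertex of `Newt(F)`, `F = Σ_i Π_j f_ij`, is the strict top of `supp F` in a direction `w` whose heights separate
all points of the frame (stub A `stub_exposedGenericDirection`); the word `a₀` with `Σ_j a₀ j = ` that top is
LEX-GREEDY for `w` (stub B `stub_topSurvivorGreedy`); greedy words are covered by `≤ (kmt+2)^c` admissible sub-boxes
`B ≤ A` with `≤ k` letters per coordinate (stub C'' `stub_coveringFamily`); by the coefficient formula (stub B2
`stub_coeffFormula`, applied to `A` and to `B`) the restriction `F|_B = Σ_i Π_j (f_ij restricted to B j)` has
`supp F|_B ⊆ supp F` and contains `Σ_j a₀ j`, so the vertex stays a vertex of `Newt(F|_B)`; count with the `k`-letter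
bound over the family.
-/

-- `Summit.ValiantsHypothesis.ValiantsHypothesis.…` is the tree's mandated single-conjunct layout (Sub = Summit).
set_option linter.dupNamespace false

namespace Summit.ValiantsHypothesis.ValiantsHypothesis.Theorems.NewtonUnitEquationsDissociatedUniform

open scoped BigOperators

namespace OfKLetterFrame

variable {k m : ℕ}

/-! ## Restriction of a polynomial and of a frame to a sub-box -/

/-- Restriction of a polynomial to the monomials of `S`: `∑_{l ∈ S} coeff l p • X^l`. -/
noncomputable def restrictTo (S : Finset (Fin 2 →₀ ℕ)) (p : MvPolynomial (Fin 2) ℂ) : MvPolynomial (Fin 2) ℂ :=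
  ∑ l ∈ S, MvPolynomial.monomial l (p.coeff l)

/-- Coefficients of the restriction. -/
theorem coeff_restrictTo (S : Finset (Fin 2 →₀ ℕ)) (p : MvPolynomial (Fin 2) ℂ) (l : Fin 2 →₀ ℕ) :
    (restrictTo S p).coeff l = if l ∈ S then p.coeff l else 0 := by
  classical
  unfold restrictTo
  rw [MvPolynomial.coeff_sum]
  simp only [MvPolynomial.coeff_monomial]
  rw [Finset.sum_ite_eq' S l (fun x => p.coeff x)]

/-- Coefficients of the restriction inside `S`. -/
theorem coeff_restrictTo_of_mem {S : Finset (Fin 2 →₀ ℕ)} (p : MvPolynomial (Fin 2) ℂ) {l : Fin 2 →₀ ℕ} (hl : l ∈ S) :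
    (restrictTo S p).coeff l = p.coeff l := by
  rw [coeff_restrictTo, if_pos hl]

/-- The restriction is supported on `S`. -/
theorem support_restrictTo (S : Finset (Fin 2 →₀ ℕ)) (p : MvPolynomial (Fin 2) ℂ) : (restrictTo S p).support ⊆ S := by
  intro l hl
  by_contra h
  rw [MvPolynomial.mem_support_iff, coeff_restrictTo, if_neg h] at hl
  exact hl rfl

/-- Tensor values of the restricted frame agree with those of the frame on words of the sub-box. -/
theorem tval_restrict {B : Fin m → Finset (Fin 2 →₀ ℕ)} (f : Fin k → Fin m → MvPolynomial (Fin 2) ℂ)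
    {a : Fin m → (Fin 2 →₀ ℕ)} (ha : a ∈ Fintype.piFinset B) :
    (∑ i, ∏ j, (restrictTo (B j) (f i j)).coeff (a j)) = ∑ i, ∏ j, (f i j).coeff (a j) := by
  refine Finset.sum_congr rfl fun i _ => Finset.prod_congr rfl fun j _ => ?_
  exact coeff_restrictTo_of_mem _ (Fintype.mem_piFinset.mp ha j)

/-- Dissociation passes to sub-frames. -/
theorem dissociated_mono {A B : Fin m → Finset (Fin 2 →₀ ℕ)}
    (hA : ∀ a b : Fin m → (Fin 2 →₀ ℕ), (∀ j, a j ∈ A j) → (∀ j, b j ∈ A j) → ∑ j, a j = ∑ j, b j → a = b)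
    (hBA : ∀ j, B j ⊆ A j) :
    ∀ a b : Fin m → (Fin 2 →₀ ℕ), (∀ j, a j ∈ B j) → (∀ j, b j ∈ B j) → ∑ j, a j = ∑ j, b j → a = b :=
  fun a b ha hb h => hA a b (fun j => hBA j (ha j)) (fun j => hBA j (hb j)) h

/-- On a dissociated frame, the support of the restricted sum of products is contained in the original support (B2 twice). -/
theorem support_restrict_subset {A B : Fin m → Finset (Fin 2 →₀ ℕ)} {f : Fin k → Fin m → MvPolynomial (Fin 2) ℂ}
    (hsupp : ∀ i j, (f i j).support ⊆ A j)
    (hdis : ∀ a b : Fin m → (Fin 2 →₀ ℕ), (∀ j, a j ∈ A j) → (∀ j, b j ∈ A j) → ∑ j, a j = ∑ j, b j → a = b)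
    (hBA : ∀ j, B j ⊆ A j) :
    (∑ i, ∏ j, restrictTo (B j) (f i j)).support ⊆ (∑ i, ∏ j, f i j).support := by
  intro e he
  have hsuppB : ∀ i j, (restrictTo (B j) (f i j)).support ⊆ B j := fun i j => support_restrictTo _ _
  obtain ⟨hcoefB, hcovB⟩ := stub_coeffFormula k m B (fun i j => restrictTo (B j) (f i j)) hsuppB (dissociated_mono hdis hBA)
  obtain ⟨hcoefA, -⟩ := stub_coeffFormula k m A f hsupp hdis
  obtain ⟨a, ha, rfl⟩ := hcovB e he
  have hne : (∑ i, ∏ j, (f i j).coeff (a j)) ≠ 0 := by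
    rw [← tval_restrict f ha, ← hcoefB a ha]
    exact MvPolynomial.mem_support_iff.mp he
  rw [MvPolynomial.mem_support_iff, hcoefA a (Fintype.piFinset_subset _ _ hBA ha)]
  exact hne

/-- A word of the sub-box with nonzero tensor value is in the support of the restricted polynomial (B2). -/
theorem sum_mem_support_restrict {A B : Fin m → Finset (Fin 2 →₀ ℕ)} {f : Fin k → Fin m → MvPolynomial (Fin 2) ℂ}
    (hdis : ∀ a b : Fin m → (Fin 2 →₀ ℕ), (∀ j, a j ∈ A j) → (∀ j, b j ∈ A j) → ∑ j, a j = ∑ j, b j → a = b)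
    (hBA : ∀ j, B j ⊆ A j) {a : Fin m → (Fin 2 →₀ ℕ)} (ha : a ∈ Fintype.piFinset B)
    (hval : (∑ i, ∏ j, (f i j).coeff (a j)) ≠ 0) :
    (∑ j, a j) ∈ (∑ i, ∏ j, restrictTo (B j) (f i j)).support := by
  have hsuppB : ∀ i j, (restrictTo (B j) (f i j)).support ⊆ B j := fun i j => support_restrictTo _ _
  obtain ⟨hcoefB, -⟩ := stub_coeffFormula k m B (fun i j => restrictTo (B j) (f i j)) hsuppB (dissociated_mono hdis hBA)
  rw [MvPolynomial.mem_support_iff, hcoefB a ha, tval_restrict f ha]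
  exact hval

/-! ## Vertices survive restriction to the covering box -/

/-- Extreme points of the hull of a set stay extreme in the hull of any subset containing them. -/
theorem mem_extremePoints_convexHull_mono {E : Type*} [AddCommGroup E] [Module ℝ E] {S T : Set E} (hST : S ⊆ T)
    {e : E} (heS : e ∈ S) (he : e ∈ (convexHull ℝ T).extremePoints ℝ) : e ∈ (convexHull ℝ S).extremePoints ℝ := by
  rw [mem_extremePoints] at he ⊢
  refine ⟨subset_convexHull ℝ S heS, fun x₁ hx₁ x₂ hx₂ hx => ?_⟩
  exact he.2 x₁ (convexHull_mono hST hx₁) x₂ (convexHull_mono hST hx₂) hx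

/-- **Every vertex of `Newt(F)` is a vertex of `Newt(F|_B)` for some box `B` of a covering family** (stubs A, B, B2). -/
theorem extremePoints_subset_cover {A : Fin m → Finset (Fin 2 →₀ ℕ)} {f : Fin k → Fin m → MvPolynomial (Fin 2) ℂ}
    (hsupp : ∀ i j, (f i j).support ⊆ A j)
    (hdis : ∀ a b : Fin m → (Fin 2 →₀ ℕ), (∀ j, a j ∈ A j) → (∀ j, b j ∈ A j) → ∑ j, a j = ∑ j, b j → a = b)
    {𝔅 : Finset (Fin m → Finset (Fin 2 →₀ ℕ))} (h𝔅 : ∀ B ∈ 𝔅, (∀ j, B j ⊆ A j) ∧ ∀ j, (B j).card ≤ k)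
    (hcover : ∀ w : Fin 2 → ℝ,
      (∀ a ∈ Fintype.piFinset A, ∀ b ∈ Fintype.piFinset A,
        (∑ i, w i * (((∑ j, a j) i : ℕ) : ℝ)) = (∑ i, w i * (((∑ j, b j) i : ℕ) : ℝ)) → a = b) →
      ∀ a ∈ {a : Fin m → (Fin 2 →₀ ℕ) | a ∈ Fintype.piFinset A ∧
          (fun i => ∏ j, (f i j).coeff (a j)) ∉ Submodule.span ℂ
            ((fun b : Fin m → (Fin 2 →₀ ℕ) => fun i => ∏ j, (f i j).coeff (b j)) ''
              {b | b ∈ Fintype.piFinset A ∧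
                (∑ i, w i * (((∑ j, a j) i : ℕ) : ℝ)) < ∑ i, w i * (((∑ j, b j) i : ℕ) : ℝ)})},
        ∃ B ∈ 𝔅, a ∈ Fintype.piFinset B) :
    Set.extremePoints ℝ (convexHull ℝ ((fun e : Fin 2 →₀ ℕ => fun i : Fin 2 => ((e i : ℕ) : ℝ)) ''
      ((∑ i, ∏ j, f i j).support : Set (Fin 2 →₀ ℕ))))
      ⊆ ⋃ B ∈ 𝔅, Set.extremePoints ℝ (convexHull ℝ ((fun e : Fin 2 →₀ ℕ => fun i : Fin 2 => ((e i : ℕ) : ℝ)) ''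
          ((∑ i, ∏ j, restrictTo (B j) (f i j)).support : Set (Fin 2 →₀ ℕ)))) := by
  classical
  intro e he
  obtain ⟨w, e₀, he₀, hee, hmax, hinj⟩ :=
    stub_exposedGenericDirection (∑ i, ∏ j, f i j).support ((Fintype.piFinset A).image fun a => ∑ j, a j) e he
  -- genericity of `w` on the box, from injectivity on the sumset and dissociation
  have hgen : ∀ a ∈ Fintype.piFinset A, ∀ b ∈ Fintype.piFinset A,
      (∑ i, w i * (((∑ j, a j) i : ℕ) : ℝ)) = (∑ i, w i * (((∑ j, b j) i : ℕ) : ℝ)) → a = b := by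
    intro a ha b hb hab
    have hpa : (∑ j, a j) ∈ (Fintype.piFinset A).image (fun a => ∑ j, a j) := Finset.mem_image_of_mem _ ha
    have hpb : (∑ j, b j) ∈ (Fintype.piFinset A).image (fun a => ∑ j, a j) := Finset.mem_image_of_mem _ hb
    have hpt : ∑ j, a j = ∑ j, b j := hinj (Finset.mem_coe.mpr hpa) (Finset.mem_coe.mpr hpb) hab
    exact hdis a b (Fintype.mem_piFinset.mp ha) (Fintype.mem_piFinset.mp hb) hpt
  obtain ⟨a₀, ha₀, hpt, hgr⟩ := stub_topSurvivorGreedy k m A f w e₀ hsupp hdis he₀ hmax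
  obtain ⟨hcoef, -⟩ := stub_coeffFormula k m A f hsupp hdis
  have hval : (∑ i, ∏ j, (f i j).coeff (a₀ j)) ≠ 0 := by
    rw [← hcoef a₀ ha₀, hpt]
    exact MvPolynomial.mem_support_iff.mp he₀
  obtain ⟨B, hB𝔅, haB⟩ := hcover w hgen a₀ hgr
  have hBA := (h𝔅 B hB𝔅).1
  have hmemB : e₀ ∈ (∑ i, ∏ j, restrictTo (B j) (f i j)).support := by
    rw [← hpt]; exact sum_mem_support_restrict hdis hBA haB hval
  refine Set.mem_iUnion₂.mpr ⟨B, hB𝔅, ?_⟩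
  refine mem_extremePoints_convexHull_mono (Set.image_mono ?_) ⟨e₀, hmemB, hee⟩ he
  exact Finset.coe_subset.mpr (support_restrict_subset hsupp hdis hBA)

/-- Counting over the covering family with the `k`-letter bound. -/
theorem ncard_extremePoints_le_of_cover {C : ℕ}
    (hD : ∀ (k m : ℕ) (A : Fin m → Finset (Fin 2 →₀ ℕ)) (f : Fin k → Fin m → MvPolynomial (Fin 2) ℂ),
      (∀ j, (A j).card ≤ k) → (∀ i j, (f i j).support ⊆ A j) →
      (∀ a b : Fin m → (Fin 2 →₀ ℕ), (∀ j, a j ∈ A j) → (∀ j, b j ∈ A j) → ∑ j, a j = ∑ j, b j → a = b) →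
      (Set.extremePoints ℝ (convexHull ℝ ((fun e : Fin 2 →₀ ℕ => fun i : Fin 2 => ((e i : ℕ) : ℝ)) ''
        ((∑ i, ∏ j, f i j).support : Set (Fin 2 →₀ ℕ))))).ncard ≤ (k * m * k + 2) ^ C)
    {A : Fin m → Finset (Fin 2 →₀ ℕ)} {f : Fin k → Fin m → MvPolynomial (Fin 2) ℂ}
    (hdis : ∀ a b : Fin m → (Fin 2 →₀ ℕ), (∀ j, a j ∈ A j) → (∀ j, b j ∈ A j) → ∑ j, a j = ∑ j, b j → a = b)
    {𝔅 : Finset (Fin m → Finset (Fin 2 →₀ ℕ))} (h𝔅 : ∀ B ∈ 𝔅, (∀ j, B j ⊆ A j) ∧ ∀ j, (B j).card ≤ k)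
    {E : Set (Fin 2 → ℝ)}
    (hE : E ⊆ ⋃ B ∈ 𝔅, Set.extremePoints ℝ (convexHull ℝ ((fun e : Fin 2 →₀ ℕ => fun i : Fin 2 => ((e i : ℕ) : ℝ)) ''
          ((∑ i, ∏ j, restrictTo (B j) (f i j)).support : Set (Fin 2 →₀ ℕ))))) :
    E.ncard ≤ 𝔅.card * (k * m * k + 2) ^ C := by
  classical
  set V : (Fin m → Finset (Fin 2 →₀ ℕ)) → Set (Fin 2 → ℝ) := fun B =>
    Set.extremePoints ℝ (convexHull ℝ ((fun e : Fin 2 →₀ ℕ => fun i : Fin 2 => ((e i : ℕ) : ℝ)) ''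
      ((∑ i, ∏ j, restrictTo (B j) (f i j)).support : Set (Fin 2 →₀ ℕ)))) with hV
  have hfin : ∀ B ∈ 𝔅, (V B).Finite := fun B _ =>
    (Set.Finite.image _ (Finset.finite_toSet _)).subset extremePoints_convexHull_subset
  have hUfin : (⋃ B ∈ 𝔅, V B).Finite := Set.Finite.biUnion (Finset.finite_toSet 𝔅) hfin
  calc E.ncard ≤ (⋃ B ∈ 𝔅, V B).ncard := Set.ncard_le_ncard hE hUfin
    _ ≤ ∑ B ∈ 𝔅, (V B).ncard := Finset.set_ncard_biUnion_le 𝔅 _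
    _ ≤ ∑ B ∈ 𝔅, (k * m * k + 2) ^ C := by
        refine Finset.sum_le_sum fun B hB => ?_
        exact hD k m B (fun i j => restrictTo (B j) (f i j)) (h𝔅 B hB).2 (fun i j => support_restrictTo _ _)
          (dissociated_mono hdis (h𝔅 B hB).1)
    _ = 𝔅.card * (k * m * k + 2) ^ C := by rw [Finset.sum_const, smul_eq_mul]

/-- `x^c * (x^2)^C = x^(2C+c)`. -/
theorem pow_mul_pow_sq (x c C : ℕ) : x ^ c * (x ^ 2) ^ C = x ^ (2 * C + c) := by
  rw [← pow_mul, ← pow_add, Nat.add_comm]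

end OfKLetterFrame

open OfKLetterFrame in
/-- **Alphabet reduction `t ↦ k` for the crux.**  If Newton polygons on dissociated frames with `≤ k` letters per
coordinate have `≤ (k·m·k + 2)^C` vertices (the line's open stub `stub_kLetterFrame`), then on every dissociated frame with
`≤ t` letters per coordinate they have `≤ (k·m·t + 2)^(2C + c)` vertices, `c` the exponent of the covering family. -/
theorem dissociatedUniform_of_kLetterFrame
    (hD : ∃ C : ℕ, ∀ (k m : ℕ) (A : Fin m → Finset (Fin 2 →₀ ℕ)) (f : Fin k → Fin m → MvPolynomial (Fin 2) ℂ),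
      (∀ j, (A j).card ≤ k) → (∀ i j, (f i j).support ⊆ A j) →
      (∀ a b : Fin m → (Fin 2 →₀ ℕ), (∀ j, a j ∈ A j) → (∀ j, b j ∈ A j) → ∑ j, a j = ∑ j, b j → a = b) →
      (Set.extremePoints ℝ (convexHull ℝ ((fun e : Fin 2 →₀ ℕ => fun i : Fin 2 => ((e i : ℕ) : ℝ)) ''
        ((∑ i, ∏ j, f i j).support : Set (Fin 2 →₀ ℕ))))).ncard ≤ (k * m * k + 2) ^ C) :
    ∃ C : ℕ, ∀ (k m t : ℕ) (A : Fin m → Finset (Fin 2 →₀ ℕ)) (f : Fin k → Fin m → MvPolynomial (Fin 2) ℂ),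
      (∀ j, (A j).card ≤ t) → (∀ i j, (f i j).support ⊆ A j) →
      (∀ a b : Fin m → (Fin 2 →₀ ℕ), (∀ j, a j ∈ A j) → (∀ j, b j ∈ A j) → ∑ j, a j = ∑ j, b j → a = b) →
      (Set.extremePoints ℝ (convexHull ℝ ((fun e : Fin 2 →₀ ℕ => fun i : Fin 2 => ((e i : ℕ) : ℝ)) ''
        ((∑ i, ∏ j, f i j).support : Set (Fin 2 →₀ ℕ))))).ncard ≤ (k * m * t + 2) ^ C := by
  classical
  obtain ⟨c, hC⟩ := stub_coveringFamily
  obtain ⟨C, hD⟩ := hD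
  refine ⟨2 * C + c, fun k m t A f hcard hsupp hdis => ?_⟩
  obtain ⟨𝔅, h𝔅card, h𝔅adm, hcover⟩ := hC k m t A f hcard hdis
  have h1 := extremePoints_subset_cover hsupp hdis h𝔅adm hcover
  have h2 := ncard_extremePoints_le_of_cover hD hdis h𝔅adm h1
  rcases Nat.eq_zero_or_pos t with rfl | ht
  · rcases Nat.eq_zero_or_pos m with rfl | hm
    · calc _ ≤ 𝔅.card * (k * 0 * k + 2) ^ C := h2
        _ ≤ (k * 0 * 0 + 2) ^ c * (k * 0 * k + 2) ^ C := Nat.mul_le_mul_right _ h𝔅card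
        _ ≤ (k * 0 * 0 + 2) ^ c * ((k * 0 * 0 + 2) ^ 2) ^ C :=
          Nat.mul_le_mul_left _ (Nat.pow_le_pow_left (by norm_num) C)
        _ = (k * 0 * 0 + 2) ^ (2 * C + c) := pow_mul_pow_sq _ _ _
    · -- `A ⟨0, hm⟩ = ∅`: no words, so the support is empty and there are no vertices
      have hj : A ⟨0, hm⟩ = ∅ := Finset.card_eq_zero.mp (Nat.le_zero.mp (hcard ⟨0, hm⟩))
      have hbox : Fintype.piFinset A = ∅ := by
        apply Finset.eq_empty_of_forall_notMem
        intro a ha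
        have := Fintype.mem_piFinset.mp ha ⟨0, hm⟩
        simp [hj] at this
      have hsupp0 : (∑ i, ∏ j, f i j).support = ∅ := by
        apply Finset.eq_empty_of_forall_notMem
        intro e he
        obtain ⟨a, ha, -⟩ := (stub_coeffFormula k m A f hsupp hdis).2 e he
        simp [hbox] at ha
      have hE : Set.extremePoints ℝ (convexHull ℝ ((fun e : Fin 2 →₀ ℕ => fun i : Fin 2 => ((e i : ℕ) : ℝ)) ''
          ((∑ i, ∏ j, f i j).support : Set (Fin 2 →₀ ℕ)))) = ∅ := by
        apply Set.subset_empty_iff.mp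
        intro e he
        have := extremePoints_convexHull_subset he
        simp [hsupp0] at this
      rw [hE, Set.ncard_empty]
      exact Nat.zero_le _
  · have hkm : k * m * k + 2 ≤ (k * m * t + 2) ^ 2 := by
      rcases Nat.eq_zero_or_pos m with rfl | hm
      · norm_num
      · have h1' : k ≤ k * m * t :=
          calc k = k * 1 * 1 := by ring
            _ ≤ k * m * t := Nat.mul_le_mul (Nat.mul_le_mul_left k hm) ht
        have h2' : k * m ≤ k * m * t := Nat.le_mul_of_pos_right _ ht
        have h3' : k * m * k ≤ (k * m * t) * (k * m * t) := Nat.mul_le_mul h2' h1'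
        nlinarith [h3']
    calc _ ≤ 𝔅.card * (k * m * k + 2) ^ C := h2
      _ ≤ (k * m * t + 2) ^ c * (k * m * k + 2) ^ C := Nat.mul_le_mul_right _ h𝔅card
      _ ≤ (k * m * t + 2) ^ c * ((k * m * t + 2) ^ 2) ^ C :=
        Nat.mul_le_mul_left _ (Nat.pow_le_pow_left hkm C)
      _ = (k * m * t + 2) ^ (2 * C + c) := pow_mul_pow_sq _ _ _

/-- **The crux is equivalent to its `k`-letter case.** -/
theorem dissociatedUniform_iff_kLetterFrame :
    Summit.ValiantsHypothesis.ValiantsHypothesis.Theses.NewtonUnitEquations.DissociatedUniform ↔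
    ∃ C : ℕ, ∀ (k m : ℕ) (A : Fin m → Finset (Fin 2 →₀ ℕ)) (f : Fin k → Fin m → MvPolynomial (Fin 2) ℂ),
      (∀ j, (A j).card ≤ k) → (∀ i j, (f i j).support ⊆ A j) →
      (∀ a b : Fin m → (Fin 2 →₀ ℕ), (∀ j, a j ∈ A j) → (∀ j, b j ∈ A j) → ∑ j, a j = ∑ j, b j → a = b) →
      (Set.extremePoints ℝ (convexHull ℝ ((fun e : Fin 2 →₀ ℕ => fun i : Fin 2 => ((e i : ℕ) : ℝ)) ''
        ((∑ i, ∏ j, f i j).support : Set (Fin 2 →₀ ℕ))))).ncard ≤ (k * m * k + 2) ^ C :=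
  ⟨fun ⟨C, hC⟩ => ⟨C, fun k m A f hcard hsupp hdis => hC k m k A f hcard hsupp hdis⟩,
    fun h => dissociatedUniform_of_kLetterFrame h⟩

end Summit.ValiantsHypothesis.ValiantsHypothesis.Theorems.NewtonUnitEquationsDissociatedUniform
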